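import Summits.RiemannHypothesis.RiemannHypothesis.Theses.SpectralTrace
import Summits.RiemannHypothesis.RiemannHypothesis.Theorems.SpectralTraceWindowCompactness
import Summits.RiemannHypothesis.RiemannHypothesis.Theorems.SpectralTraceSpectralThesisStubClosedLadder
import Summits.RiemannHypothesis.RiemannHypothesis.Theorems.SpectralTraceSpectralThesisStubBaseRung
import Summits.RiemannHypothesis.RiemannHypothesis.Theorems.SpectralTraceSpectralThesisOpenLadderCalibration

/-!
# Crux `SpectralThesis` (stmt-RiemannHypothesis-0187) — line `Sketch`: the window ladder as a
continuity method (lead skeleton, rev 7, seat c2)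

Crux (route SpectralTrace, rank 0, the thesis `X`):
`SpectralThesis : ∃ (ι : Type) (γ : ι → ℝ), ∀ g, IsWeilTest g →
   HasSum (i ↦ ĝ(1/2 + iγ_i)) (W g)` — kernel-checked equivalent to the Riemann hypothesis
(`Cruxes/SpectralThesis/Disproof.lean`, `spectralThesis_iff_riemannHypothesis`).

The line (card `window-continuity-method`): the set of windows `A > 0` whose OPEN window
`(-A, A)` carries a rung is a down-set of `(0, ∞)`; if it is non-empty (BASE), open (OPEN: every
rung extends a little) and closed under increasing limits (CLOSED), it is all of `(0, ∞)`, which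
is the ladder, which is `X` (`windowCompactness_proof`, landed).

State of the line at rev 7 (everything but ONE stub is a landed theorem, imported — rev 5 inlined
the BaseRung glue, rev 6/7 import it; rev 7 documents the landed threshold normal form p120131 + p120289):
* BASE  = `stub_baseRung`   — PROVED unconditionally (exact warped-lattice quadrature by
  contraction; `Theorems/SpectralTraceSpectralThesisStubBaseRung.lean`, p116629, over the six
  landed construction stubs p100881 p115277 p100098 p100324 p101043 p116311).
* CLOSED = `stub_closedLadder` — PROVED (cell-wise ultrafilter limit of witnesses + uniform local
  Weyl bound; `Theorems/SpectralTraceSpectralThesisStubClosedLadder.lean` p91348, cells p87914).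
* OPEN  = `stub_openLadder` — the ONLY `sorry` of this file; kernel-checked EQUIVALENT to the
  Riemann hypothesis with no seed hypothesis (`openLadder_iff_riemannHypothesis`, p116629, restated
  below in the calibration section).
* ANCHOR `stub_breakingWindow` — PROVED (RH-free threshold normal form of the residue,
  `Theorems/SpectralTraceSpectralThesisBreakingWindow.lean`, p120131, p120289): `¬RH ↔` the rung set
  `{A > 0 | Rung(A)}` is `(0, A*]` for a sharp attained breaking window `A* > 0`; see the last
  section.
Composition `SpectralThesis_of (hO : Registered.stub_openLadder)` concludes the crux by name.
-/

noncomputable section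

set_option linter.dupNamespace false

namespace Summit.RiemannHypothesis.RiemannHypothesis.Cruxes.SpectralThesis.Sketch

open Complex Set
open Literature.NumberTheory.LFunctions
open Summit.RiemannHypothesis.RiemannHypothesis.Theses.SpectralTrace
open Summit.RiemannHypothesis.RiemannHypothesis.Theorems

/-! ## Vocabulary -/

/-- `OpenWindowRung A`: some real family `γ` reproduces the Weil functional on every Weil test
supported in the OPEN window `(-A, A)`. -/
def OpenWindowRung (A : ℝ) : Prop :=
  ∃ (ι : Type) (γ : ι → ℝ), ∀ g : ℝ → ℂ, IsWeilTest g → tsupport g ⊆ Set.Ioo (-A) A →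
    HasSum (fun i => weilMellin g (1 / 2 + (γ i : ℂ) * I)) (weilFunctional g)

/-- Rungs are monotone: a witness for a bigger open window serves every smaller one. -/
theorem openWindowRung_mono {A A' : ℝ} (h : A ≤ A') (hA' : OpenWindowRung A') :
    OpenWindowRung A :=
  SpectralThesis.Sketch.rung_mono h hA'

/-- An open-window rung at `A + ε` (`ε > 0`) gives the route's closed-window rung at `A`. -/
theorem Icc_rung_of_openWindowRung {A ε : ℝ} (hε : 0 < ε) (h : OpenWindowRung (A + ε)) :
    ∃ (ι : Type) (γ : ι → ℝ), ∀ g : ℝ → ℂ, IsWeilTest g → tsupport g ⊆ Set.Icc (-A) A →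
      HasSum (fun i => weilMellin g (1 / 2 + (γ i : ℂ) * I)) (weilFunctional g) := by
  obtain ⟨ι, γ, hγ⟩ := h
  exact ⟨ι, γ, fun g hg hgs => hγ g hg (hgs.trans (Icc_subset_Ioo (by linarith) (by linarith)))⟩

/-- BASE: some positive open window carries a rung. -/
def BaseRung : Prop :=
  ∃ A₀ : ℝ, 0 < A₀ ∧ ∃ (ι : Type) (γ : ι → ℝ), ∀ g : ℝ → ℂ, IsWeilTest g →
    tsupport g ⊆ Set.Ioo (-A₀) A₀ →
      HasSum (fun i => weilMellin g (1 / 2 + (γ i : ℂ) * I)) (weilFunctional g)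

/-- OPEN: every rung extends a little (the continuation / a-priori content of the line). -/
def OpenLadder : Prop :=
  ∀ A : ℝ, 0 < A →
    (∃ (ι : Type) (γ : ι → ℝ), ∀ g : ℝ → ℂ, IsWeilTest g → tsupport g ⊆ Set.Ioo (-A) A →
      HasSum (fun i => weilMellin g (1 / 2 + (γ i : ℂ) * I)) (weilFunctional g)) →
    ∃ ε : ℝ, 0 < ε ∧ ∃ (ι : Type) (γ : ι → ℝ), ∀ g : ℝ → ℂ, IsWeilTest g →
      tsupport g ⊆ Set.Ioo (-(A + ε)) (A + ε) →
        HasSum (fun i => weilMellin g (1 / 2 + (γ i : ℂ) * I)) (weilFunctional g)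

/-- CLOSED: rungs on every smaller open window give a rung on the limit window. -/
def ClosedLadder : Prop :=
  ∀ A : ℝ, 0 < A →
    (∀ A' : ℝ, 0 < A' → A' < A → ∃ (ι : Type) (γ : ι → ℝ), ∀ g : ℝ → ℂ, IsWeilTest g →
      tsupport g ⊆ Set.Ioo (-A') A' →
        HasSum (fun i => weilMellin g (1 / 2 + (γ i : ℂ) * I)) (weilFunctional g)) →
    ∃ (ι : Type) (γ : ι → ℝ), ∀ g : ℝ → ℂ, IsWeilTest g → tsupport g ⊆ Set.Ioo (-A) A →
      HasSum (fun i => weilMellin g (1 / 2 + (γ i : ℂ) * I)) (weilFunctional g)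

/-! ## The registered stubs (`sorry` lives only in `stub_openLadder`) -/

/-- **STUB · `stub_openLadder`** (= `OpenLadder` verbatim; held by the lead). RH-STRENGTH:
`openLadder_iff_riemannHypothesis_unconditional` below shows it is EQUIVALENT to the Riemann
hypothesis with no further hypothesis. -/
theorem stub_openLadder :
    ∀ A : ℝ, 0 < A →
      (∃ (ι : Type) (γ : ι → ℝ), ∀ g : ℝ → ℂ, IsWeilTest g → tsupport g ⊆ Set.Ioo (-A) A →
        HasSum (fun i => weilMellin g (1 / 2 + (γ i : ℂ) * I)) (weilFunctional g)) →
      ∃ ε : ℝ, 0 < ε ∧ ∃ (ι : Type) (γ : ι → ℝ), ∀ g : ℝ → ℂ, IsWeilTest g →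
        tsupport g ⊆ Set.Ioo (-(A + ε)) (A + ε) →
          HasSum (fun i => weilMellin g (1 / 2 + (γ i : ℂ) * I)) (weilFunctional g) := by
  sorry

/-- **STUB · `stub_baseRung`** (= `BaseRung` verbatim) — CLOSED: proved unconditionally in the tree
(`Theorems/SpectralTraceSpectralThesisStubBaseRung.lean`, p116629). -/
theorem stub_baseRung :
    ∃ A₀ : ℝ, 0 < A₀ ∧ ∃ (ι : Type) (γ : ι → ℝ), ∀ g : ℝ → ℂ, IsWeilTest g →
      tsupport g ⊆ Set.Ioo (-A₀) A₀ →
        HasSum (fun i => weilMellin g (1 / 2 + (γ i : ℂ) * I)) (weilFunctional g) :=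
  Summit.RiemannHypothesis.RiemannHypothesis.Theorems.SpectralThesis.Sketch.stub_baseRung

/-- **STUB · `stub_closedLadder`** (= `ClosedLadder` verbatim) — CLOSED: proved in the tree
(`Theorems/SpectralTraceSpectralThesisStubClosedLadder.lean`, p91348). -/
theorem stub_closedLadder :
    ∀ A : ℝ, 0 < A →
      (∀ A' : ℝ, 0 < A' → A' < A → ∃ (ι : Type) (γ : ι → ℝ), ∀ g : ℝ → ℂ, IsWeilTest g →
        tsupport g ⊆ Set.Ioo (-A') A' →
          HasSum (fun i => weilMellin g (1 / 2 + (γ i : ℂ) * I)) (weilFunctional g)) →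
      ∃ (ι : Type) (γ : ι → ℝ), ∀ g : ℝ → ℂ, IsWeilTest g → tsupport g ⊆ Set.Ioo (-A) A →
        HasSum (fun i => weilMellin g (1 / 2 + (γ i : ℂ) * I)) (weilFunctional g) :=
  Summit.RiemannHypothesis.RiemannHypothesis.Theorems.SpectralThesis.Sketch.stub_closedLadder

/-! ### Consistency: each named statement IS its stub (definitionally) -/

theorem baseRung_holds : BaseRung := stub_baseRung
theorem openLadder_holds : OpenLadder := stub_openLadder
theorem closedLadder_holds : ClosedLadder := stub_closedLadder

/-! ### Name-keyed aliases of the three statements (the hypotheses of the composition) -/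
namespace Registered

/-- Alias of `BaseRung` keyed by the registered stub name. -/
abbrev stub_baseRung : Prop := BaseRung
/-- Alias of `OpenLadder` keyed by the registered stub name. -/
abbrev stub_openLadder : Prop := OpenLadder
/-- Alias of `ClosedLadder` keyed by the registered stub name. -/
abbrev stub_closedLadder : Prop := ClosedLadder

end Registered

/-! ## Proved glue: the continuity method on `(0, ∞)` -/

/-- Every open window carries a rung, from the three statements (continuity method
`forall_pos_of_continuity`, landed p92634). -/
theorem forall_openWindowRung (hB : BaseRung) (hO : OpenLadder) (hC : ClosedLadder) :
    ∀ A : ℝ, 0 < A → OpenWindowRung A :=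
  SpectralThesis.Sketch.forall_pos_of_continuity (P := OpenWindowRung)
    (fun hxy hy => openWindowRung_mono hxy hy) hB hO hC

/-- The route's closed-window ladder `∀ A > 0, Trace(A)`, from the three statements. -/
theorem ladder_of_stubs (hB : BaseRung) (hO : OpenLadder) (hC : ClosedLadder) :
    ∀ A : ℝ, 0 < A → ∃ (ι : Type) (γ : ι → ℝ), ∀ g : ℝ → ℂ, IsWeilTest g →
      tsupport g ⊆ Set.Icc (-A) A →
        HasSum (fun i => weilMellin g (1 / 2 + (γ i : ℂ) * I)) (weilFunctional g) :=
  fun A hA => Icc_rung_of_openWindowRung one_pos (forall_openWindowRung hB hO hC (A + 1) (by linarith))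

/-! ## The composition: the stubs imply the crux, BY NAME (kernel-checked; no `sorry` below) -/

/-- **`SpectralThesis_of`** — the glue of the line: openness (the one OPEN, RH-sized stub) with the
landed base (`baseRung_holds`) and the landed closedness (`closedLadder_holds`) give every open rung,
hence the closed-window ladder, hence `X` by the landed `windowCompactness_proof`. -/
theorem SpectralThesis_of (hO : Registered.stub_openLadder) :
    Summit.RiemannHypothesis.RiemannHypothesis.Theses.SpectralTrace.SpectralThesis := by
  unfold SpectralThesis
  exact windowCompactness_proof (ladder_of_stubs baseRung_holds hO closedLadder_holds)

/-- Wiring check: the registered open stub feeds `SpectralThesis_of` as stated. -/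
example : Summit.RiemannHypothesis.RiemannHypothesis.Theses.SpectralTrace.SpectralThesis :=
  SpectralThesis_of stub_openLadder

/-! ## Calibration (sorry-free): the remaining stub IS the Riemann hypothesis -/

/-- **OPEN ↔ RH, unconditionally** (base and closedness being theorems): the one open stub of the
line carries exactly the Riemann hypothesis (landed `openLadder_iff_riemannHypothesis`, p116629). -/
theorem openLadder_iff_riemannHypothesis_unconditional : OpenLadder ↔ _root_.RiemannHypothesis :=
  Summit.RiemannHypothesis.RiemannHypothesis.Theorems.SpectralThesis.Sketch.openLadder_iff_riemannHypothesis

/-- **`X ↔ OPEN`, unconditionally** (landed `spectralThesis_iff_openLadder`, p116629). -/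
theorem spectralThesis_iff_openLadder_unconditional : SpectralThesis ↔ OpenLadder :=
  Summit.RiemannHypothesis.RiemannHypothesis.Theorems.SpectralThesis.Sketch.spectralThesis_iff_openLadder

/-- `X ↔ RH` through the line (the same content as `Disproof.lean` §1, re-derived from the line's
own landed pieces). -/
theorem spectralThesis_iff_riemannHypothesis_via_line : SpectralThesis ↔ _root_.RiemannHypothesis :=
  spectralThesis_iff_openLadder_unconditional.trans openLadder_iff_riemannHypothesis_unconditional

/-! ## Threshold normal form of the residue (landed p120131 + p120289, RH-free; not imported here)

`Theorems/SpectralTraceSpectralThesisBreakingWindow.lean` (namespace `…Theorems.SpectralThesis.Sketch`):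
`stub_breakingWindow : ¬ RH ↔ ∃ A* > 0, ∀ A > 0, (OpenWindowRung A ↔ A ≤ A*)` — so
`¬ stub_openLadder ↔` the ladder built on the landed base BREAKS at one sharp, attained window
`A*`; `riemannHypothesis_or_exists_breakingWindow`, `breakingWindow_unique`,
`spectralThesis_iff_rungs_unbounded`, `weilPositivityOn_of_two_mul_lt_breakingWindow`,
`breakingWindow_le_two_mul_of_not_weilPositivityOn` (`A* ≤ 2a` at every Weil-negative half-width),
`log_two_le_breakingWindow_of_windowTraceArch`, `exists_failing_step_of_windowTraceArch_of_not_riemannHypothesis`.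
What refuting the last stub would have to exhibit is that one real number. -/

end Summit.RiemannHypothesis.RiemannHypothesis.Cruxes.SpectralThesis.Sketch

end
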